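import Summits.QuantumFields.YangMills.Theorems.UnitScaleTiltFluctuationComparisonRegPrGlobalSlackKernelLegCfgVariational
import Summits.QuantumFields.YangMills.Theorems.UnitScaleTiltFluctuationComparisonRegPrGlobalSlackLegCfgLipschitzT3
import Summits.QuantumFields.YangMills.Theorems.AlphaInputsT3ACv3EMLTwoFieldIterUniformAllL
import HarnessLib

/-!
# `UnitScaleTiltFluctuationComparisonRegPrGlobalSlackKernelLegCfgFineScales` — THE SCALES OF THE FINE-COMPARISON ROUTE TO THE LOOP-VARIABLE CAUCHY ROW: THE CHART MAPS ARE
# `L^j`-LIPSCHITZ (PRINT'S [Balaban1985Averaging] PROP. 6 SHAPE), THE FINE COMPARISON IS OF ORDER `b`, AND THE ROW FOLLOWS AT EVERY CHART LEVEL WITH ANY RATE `a ≤ b − 1`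
# (crux `FluctuationComparisonRegPrIntL`, stmt-QuantumFields-20520, skeleton v5kD, STUB 3⁗χ; cell `pub/ym-inputs`, seat ym-inputs-p12 gen 3 = INPUT-LIST I-11 row
# `CfgDistCauchyΦ`; count-neutral helper, registry untouched)

WHY.  The sibling file `…KernelLegCfgFixedPointFine` §2 (`cfgDistCauchyΦ_of_fineComparison`, `cfgRefOwnΦ_of_fineComparison`; same seat, gen 0) derives the I-11 row
`CfgDistCauchyΦ D B dist b₀ p₀ a C_B` — leg by leg `‖B′(c′) − B(c)‖ ≤ C_B·(1 + d(c))·θ(n)·x_j²·(L^{−(1+j)})^a`, `x_j = (L^{K−n−1−j})⁻¹` — from ONE comparison `δ(U_K, Ū_{K+1})`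
of the two runs' fine backgrounds, pushed through chart-level maps `Φ_j` that are ASSUMED legwise Lipschitz with the factor `(1 + d(c))·x_j²` (display (Lip)) and a
comparison of depth rate `(L^{−(K−n)})^a` (display (Fine)).  A scale audit of that pair of displays (memo `pub/ym-inputs/CFGCAUCHY-SCALES-p12g3.md`):

* The factor `x_j²` is the (44) SIZE factor of the loop variables ([Balaban1985UV3] (44) p.267; in the tree `…GlobalSlackLegCfgDistT3.norm_B27T_iter_blockAvg_le_T3`), NOT a
  Lipschitz constant.  For the minimiser's loop variables `Φ_j = (27) ∘ Ū^j` (the (27) axial logarithms of the `j`-fold block average), the Lipschitz constant in the bondwise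
  sup distance of the two FINE configurations GROWS like `L^j`: [Balaban1985Averaging] Proposition 6 (164) p.43, «`|\overline{U′U₀}^k (Ū₀^k)⁻¹ − 1| < O(1)α₁`» with
  `α₁ ↔ L^kη·sup_b|U′_b − 1|` by (161)–(163) — `k`-UNIFORM.  In the tree: on `ℤᵈ` `B7Eq162General.eq164_general` (constant `136(d+1)·L^k·b`); on the torus with the
  `exp[mean log]` average of record `EMLTwoField.norm_iter_sub_iter_sub_iterLin_le_uniform` (`…v3EMLTwoFieldIterUniform`, first conjunct: `‖Ū₁^{(s)}(c) − Ū₂^{(s)}(c)‖ ≤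
  4|n|²(d+1)·L^s·ρ`, flat gauge, `s`-uniform; every `L`: `EMLIterUniformAllL.…_allL`) and its local gauge-covariant form `Prop7FibreLevelSup.norm_pertVar_iter_le_of_gauge`
  (`‖pertVar Ū₀^{(j)} W̄^{(j)}(b)‖ ≤ 2(d+1)·L^j·ρ`); the (27) half is `…GlobalSlackLegCfgLipschitzT3.norm_B27T_su_sub_le_canonLegDist` (`2(1−ρ)⁻¹(1 + d(c))`).  So (Lip♮)
  below is the display these lemmas meet BY NAME (modulo the local gauge data they carry); (Lip) with `x_j²` is not.
* Reading (Lip) with `δ :=` the bondwise sup distance `s` therefore forces the rescaling `δ = s·L⁻²·η⁻²` (`η = L^{−(K−n)}`, from the level `j = 0`), after which (Fine) at the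
  depth rate asks `s ≤ C·θ(n)·η^{2+a}` — ONE POWER OF `η` MORE than the row needs.  Feeding each chart level its own rate instead, a comparison of ORDER `b` in the plain
  distance, `s ≤ C_f·θ(n)·η^b` with `b ≥ 2` and `b ≥ 1 + a`, gives the row at EVERY level `j < K − n`: the pure arithmetic is
  `L^j·(L^{−N})^b ≤ (L^{−(N−1−j)})²·(L^{−(1+j)})^a` for `j + 1 ≤ N` (§1, slack `L^{N(b−2) + (2−a) + (1−a)j} ≥ L` resp. `≥ L^{N(b−1−a)+1}`).  First-order consistency
  (`b = 2`) gives the rate `a = 1`; second-order (`b = 3`) gives every `a ≤ 2`.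

WHAT THIS FILE PROVES (def-free; `S`, `U`, `Ū`/`U_ref`, `Φ`, `δ` FREE exactly as in the sibling file; every hypothesis INLINE).
* §1 **`levelScale_le`** — the arithmetic above for a real base `1 ≤ L` and real exponents `a`, `b` with `2 ≤ b`, `a + 1 ≤ b` (no sign condition on `a`); **`levelScale_le_T3`** — the same in the
  currency of the rows (`F.L`, run `K`, height `n`, chart level `j < K − n`).
* §2 **`cfgDistCauchyΦ_of_fineComparison_scale`** — THE I-11 ROW FROM A FINE COMPARISON OF ORDER `b` THROUGH `L^j`-LIPSCHITZ CHART MAPS: displays (B), (B′) of the sibling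
  theorem verbatim; (Lip♮) `‖Φ(U) c − Φ(Ū) c‖ ≤ L_Φ·(1 + d(c))·L^j·δ(U, Ū)` (print's (164) shape); (Fine_b) `δ(U_K, Ū_{K+1}) ≤ C_f·θ(n)·((L^{K−n})⁻¹)^b`; then
  `CfgDistCauchyΦ D B dist b₀ p₀ a (L_Φ·C_f)` for every rate `a` with `a + 1 ≤ b`.  **`cfgRefOwnΦ_of_fineComparison_scale`** — the reference form (R5) `CfgRefOwnΦ` likewise.
* §2b **`cfgDistCauchyΦ_of_variational_scale`** — gen 2's variational form (`…KernelLegCfgVariational.cfgDistCauchyΦ_of_variational`, (Crit)(Mono)(Grad)) with (Lip♮) and (Rate_b)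
  `Λ ≤ m·C_f·θ(n)·((L^{K−n})⁻¹)^b` in place of (Lip)[x_j²] and (Rate)[a]: the same one-order gain for the Hilbert route.
* §3 **`norm_B27T_iter_sub_le_of_twoField`** / **`norm_B27T_iter_sub_le_canonLegDist_of_twoField`** — (Lip♮) MET BY NAME FOR THE NATURAL CHART MAPS `Φ♮_j = (27) ∘ Ū^{(j)}` (the
  tree's `exp[mean log]` average of record, flat gauge): the every-`L` two-field row `EMLIterUniformAllL.norm_iter_sub_iter_sub_iterLin_le_uniform_allL` (first conjunct,
  `‖Ū₁^{(j)}(b) − Ū₂^{(j)}(b)‖ ≤ 2(d+1)·L^j·ρ`, `j ≤ k ≤ m + K`, four smallness rows, NO `L`-floor) composed with `norm_B27T_su_sub_le` / `norm_B27T_su_sub_le_canonLegDist` of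
  `…GlobalSlackLegCfgLipschitzT3`: `‖Φ♮_j(U₁)(c) − Φ♮_j(U₂)(c)‖ ≤ 2(1−ρ′)⁻¹·(1 + canonLegDist F K j Y c)·8·(F.L)^j·ρ` on T³ (SU(2), d = 3) — the constant GROWS like `L^j`, as §1–§2 book.
HONEST FRAMING.  Arithmetic and bookkeeping on the sibling file's free letters; it records WHICH comparison the row needs (order `b ≥ max(2, 1 + a)` in the plain bondwise
distance at the finest level) and WHICH Lipschitz display the chart maps can honestly meet (`L^j`, print's Prop. 6).  (Fine_b) — the two-cut-off consistency of the two runs'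
constrained minimisers — is the located-UNPRINTED input for the non-abelian d = 3 model (INPUT-LIST §5 item 3; gen 2's (Cur) divided by the stability modulus); §3 composes
two accepted tree lemmas and displays their hypotheses (flat gauge `‖U₂,b − 1‖ ≤ δ`, bondwise closeness `ρ`, four smallness rows, log-disc rows) — the (T1)-type local-gauge data the
cell displays elsewhere; the local gauge-covariant variant is `Prop7FibreLevelSup.norm_pertVar_iter_le_of_gauge` (not re-derived).  Nothing of [Balaban1985Averaging] / [Balaban1985UV3] /
[Balaban1985Variational] / [King1986] is asserted; no summit / rung / gap claim (YM₃ on T³ is rung R3, not the Clay problem).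

References: T. Bałaban, CMP 98 (1985) 17–51 [Balaban1985Averaging] (Prop. 6 (159)–(164) pp.42–43, Prop. 4 (131)); CMP 102 (1985) 255–275 [Balaban1985UV3] ((27) p.263,
(43)–(45) pp.266–267); CMP 102 (1985) 277–309 [Balaban1985Variational] ((47)–(55) pp.285–286); C. King, CMP 102 (1986) 649–677 [King1986] (Prop. 3.8 (3.71) p.664,
Prop. 3.9 (3.73)–(3.74) p.665).
-/

set_option autoImplicit false

noncomputable section

open scoped BigOperators RealInnerProductSpace
open Finset Filter Topology
open Literature.MathematicalPhysics.QuantumFieldTheory.Balaban1983to89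
open Literature.MathematicalPhysics.QuantumFieldTheory.Balaban1983to89.T3ContinuumYM3Torus
open Literature.MathematicalPhysics.QuantumFieldTheory.Balaban1983to89.T3UnitScaleTilt
open Literature.MathematicalPhysics.QuantumFieldTheory.Balaban1983to89.T3LevelShift
open Literature.MathematicalPhysics.QuantumFieldTheory.Balaban1983to89.T3AlphaInputsAC
open Literature.MathematicalPhysics.QuantumFieldTheory.Balaban1983to89.T3AlphaPolymerSocket
open Literature.MathematicalPhysics.QuantumFieldTheory.Balaban1983to89.T3AlphaInputsACTwoRun
open Literature.MathematicalPhysics.QuantumFieldTheory.Balaban1983to89.T3AlphaInputsACTwoRunLevel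
open Literature.MathematicalPhysics.QuantumFieldTheory.Balaban1985CMP102
open Literature.MathematicalPhysics.QuantumFieldTheory.Balaban1985CMP102.Setting
open Summit.QuantumFields.Balaban3D.Carriers
open Summit.QuantumFields.Balaban3D.Proofs.Primitives
open Summit.QuantumFields.Balaban3D.Proofs.GroupModelLieC (lieC)
open Summit.QuantumFields.YangMills.Theorems
open Summit.QuantumFields.YangMills.Theorems.GlobalSlackKernelMatching
open Summit.QuantumFields.YangMills.Theorems.GlobalSlackCanonicalPolymers

namespace Summit.QuantumFields.YangMills.Theorems.GlobalSlackKernelLeg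

/-! ## §1 The scale arithmetic: an `L^j`-Lipschitz chart map and a comparison of order `b` meet the row's budget `x_j²·(L^{−(1+j)})^a` whenever `a + 1 ≤ b`, `2 ≤ b` -/

section Scales

/-- **THE LEVEL-BY-LEVEL BUDGET**: for a real base `1 ≤ L`, real exponents `a`, `b` with `2 ≤ b`, `a + 1 ≤ b`, and `j + 1 ≤ N`,
`L^j·((L^N)⁻¹)^b ≤ ((L^{N−1−j})⁻¹)²·((L^{1+j})⁻¹)^a` — in exponents `j − N·b ≤ −2(N−1−j) − (1+j)·a`, i.e. `0 ≤ N(b−2) + (2−a) + j(1−a)` (for `a ≤ 1` every term is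
nonnegative; for `a > 1` use `j ≤ N − 1` and `b ≥ 1 + a`: the sum is `≥ N(b−1−a) + 1`).  Here `L^j` is the Lipschitz growth of a `j`-fold block average
([Balaban1985Averaging] Prop. 6 (164)), `((L^N)⁻¹)^b` a comparison of order `b` at depth `N = K − n`, and the right-hand side the row's size-times-rate factor.
[cite: Balaban1985Averaging, Prop. 6 (164) p.43; King1986, Prop. 3.8 (3.71) p.664] -/
theorem levelScale_le {L : ℝ} (hL : 1 ≤ L) {a b : ℝ} (hb2 : 2 ≤ b) (hab : a + 1 ≤ b) {j N : ℕ} (hjN : j + 1 ≤ N) :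
    L ^ j * ((L ^ N)⁻¹) ^ b ≤ ((L ^ (N - 1 - j))⁻¹) ^ 2 * ((L ^ (1 + j))⁻¹) ^ a := by
  have hL0 : 0 < L := by linarith
  -- everything as a real power of `L`
  have hcast : ((N - 1 - j : ℕ) : ℝ) = (N : ℝ) - 1 - j := by
    have h : (N - 1 - j : ℕ) + 1 + j = N := by omega
    have h' := congrArg (Nat.cast (R := ℝ)) h
    push_cast at h'
    linarith
  have h1 : L ^ j = L ^ (j : ℝ) := (Real.rpow_natCast L j).symm
  have h2 : ((L ^ N)⁻¹) ^ b = L ^ (-(N : ℝ) * b) := by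
    rw [← Real.rpow_natCast L N, ← Real.rpow_neg hL0.le, ← Real.rpow_mul hL0.le]
  have h3 : ((L ^ (N - 1 - j))⁻¹) ^ 2 = L ^ (-((N : ℝ) - 1 - j) * (2 : ℕ)) := by
    rw [← Real.rpow_natCast L (N - 1 - j), hcast, ← Real.rpow_neg hL0.le, Real.rpow_mul_natCast hL0.le]
  have h4 : ((L ^ (1 + j))⁻¹) ^ a = L ^ (-(1 + (j : ℝ)) * a) := by
    rw [← Real.rpow_natCast L (1 + j), ← Real.rpow_neg hL0.le, ← Real.rpow_mul hL0.le]
    push_cast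
    ring_nf
  rw [h1, h2, h3, h4, ← Real.rpow_add hL0, ← Real.rpow_add hL0]
  refine Real.rpow_le_rpow_of_exponent_le hL ?_
  -- the exponent inequality `j − N b ≤ −2(N−1−j) − (1+j) a`
  have hjN' : (j : ℝ) + 1 ≤ N := by exact_mod_cast hjN
  have hj0 : (0 : ℝ) ≤ j := Nat.cast_nonneg j
  have hN0 : (0 : ℝ) ≤ N := Nat.cast_nonneg N
  push_cast
  rcases le_or_gt a 1 with ha1 | ha1
  · nlinarith [mul_nonneg hN0 (sub_nonneg.2 hb2), mul_nonneg hj0 (sub_nonneg.2 ha1)]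
  · nlinarith [mul_nonneg (show (0 : ℝ) ≤ N - 1 - j by linarith) (sub_nonneg.2 ha1.le),
      mul_nonneg hN0 (show (0 : ℝ) ≤ b - 1 - a by linarith)]

variable {F : T3Family}

/-- **The same in the currency of the rows**: run `K`, height `n ≤ K`, chart level `j < K − n`, base `F.L ≥ 1`:
`(F.L)^j·(((F.L)^{K−n})⁻¹)^b ≤ (((F.L)^{K−n−1−j})⁻¹)²·(((F.L)^{1+j})⁻¹)^a`. [cite: Balaban1985Averaging, Prop. 6 (164) p.43; King1986, Prop. 3.8 (3.71) p.664] -/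
theorem levelScale_le_T3 (hL : 1 ≤ F.L) {a b : ℝ} (hb2 : 2 ≤ b) (hab : a + 1 ≤ b) {K n j : ℕ} (hj : j < K - n) :
    (F.L : ℝ) ^ j * ((((F.L : ℝ) ^ (K - n))⁻¹) ^ b) ≤ (((F.L : ℝ) ^ (K - n - 1 - j))⁻¹) ^ 2 * (((F.L : ℝ) ^ (1 + j))⁻¹) ^ a := by
  have hLr : (1 : ℝ) ≤ F.L := by exact_mod_cast hL
  exact levelScale_le hLr hb2 hab (N := K - n) (by omega)

end Scales

/-! ## §2 The loop-variable rows from a fine comparison of order `b` pushed through `L^j`-Lipschitz chart maps -/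

section Fine

variable {𝕍 : Type} [NormedAddCommGroup 𝕍] [NormedSpace ℂ 𝕍] {F : T3Family} {γ : ℝ}

omit [NormedSpace ℂ 𝕍] in
/-- **THE I-11 ROW `CfgDistCauchyΦ` FROM A FINE COMPARISON OF ORDER `b` THROUGH `L^j`-LIPSCHITZ CHART MAPS.**  Free data as in `cfgDistCauchyΦ_of_fineComparison`: run `K`'s fine
configurations `S K`, run `K`'s fine background `U K k W`, run `K+1`'s once-averaged fine background `Ubar K k k′ W′` read on run `K`'s lattice, the chart-level loop-variable maps
`Φ K k j Y : S K → (bonds → 𝕍)` and a comparison `δ K k : S K → S K → ℝ`.  Displays: (B) `B K (K−n) j Y (V↑) = Φ … (U …)` and (B′) the intertwining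
`B (K+1) (K+1−n) (j+1) (refineSet Y) (V↑′) (matchBond c) = Φ K (K−n) j Y (Ubar …) c` VERBATIM as there; (Lip♮) THE HONEST LIPSCHITZ DISPLAY — legwise
`‖Φ(U) c − Φ(Ubar) c‖ ≤ L_Φ·(1 + d(c))·L^j·δ(U, Ubar)`, the constant growing like `L^j` with the chart level ([Balaban1985Averaging] Prop. 6 (164): the `j`-fold average is
`O(1)·L^j`-Lipschitz in the bondwise sup distance, `j`-uniformly; times the (27) factor `(1 + d(c))`); (Fine_b) A COMPARISON OF ORDER `b` at the depth `K − n`: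
`δ(U_K, Ubar_{K+1}) ≤ C_f·θ(n)·((L^{K−n})⁻¹)^b` — the ONE analytic input (located-unprinted for the non-abelian d = 3 model).  Then, for every rate `a` with `a + 1 ≤ b`
(and `2 ≤ b`): `CfgDistCauchyΦ D B dist b₀ p₀ a (L_Φ·C_f)` — first-order consistency `b = 2` gives `a = 1`, second-order `b = 3` every `a ≤ 2`.
[cite: Balaban1985Averaging, Prop. 6 (164) p.43; King1986, Prop. 3.8 (3.71) p.664, Prop. 3.9 (3.73)-(3.74) p.665; Balaban1985UV3, (27) p.263, (44) p.267] -/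
theorem cfgDistCauchyΦ_of_fineComparison_scale {D : AlphaDataT3 F γ} {B : CfgFam 𝕍 F} {dist : LegDist F} {b₀ p₀ a b L_Φ C_f : ℝ} (S : ℕ → Type)
    (U : (K k : ℕ) → GaugeField (F.P K) k (Matrix.specialUnitaryGroup (Fin 2) ℂ) → S K)
    (Ubar : (K k k' : ℕ) → GaugeField (F.P (K + 1)) k' (Matrix.specialUnitaryGroup (Fin 2) ℂ) → S K)
    (Φ : (K k b : ℕ) → Set (Site (F.P K) 0) → S K → (PBond (F.P K) b → 𝕍)) (δ : (K k : ℕ) → S K → S K → ℝ)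
    (hn : DistNonneg dist) (hL : 1 ≤ F.L) (hγ : 0 < γ) (hγ1 : γ ≤ 1) (hb : 0 < b₀) (hLΦ : 0 ≤ L_Φ) (hCf : 0 ≤ C_f)
    (hb2 : 2 ≤ b) (hab : a + 1 ≤ b)
    (hB : ∀ (K n : ℕ) (h : n ≤ K), ∀ j : ℕ, j < K - n →
      ∀ V : GaugeField (F.P n) 0 (Matrix.specialUnitaryGroup (Fin 2) ℂ), PlaqSmall (θBal F.L γ b₀ p₀ n) V →
        ∀ Y ∈ D.Loc K (K - n) (D.triv K (K - n)) (1 + j),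
          B K (K - n) j Y (fieldShift (F.sitesPerDir_eq (m := F.m) (K := K) (j := K - n) (m' := F.m) (K' := n) (j' := 0) (by omega)) V) = Φ K (K - n) j Y (U K (K - n) (fieldShift (F.sitesPerDir_eq (m := F.m) (K := K) (j := K - n) (m' := F.m) (K' := n) (j' := 0) (by omega)) V)))
    (hB' : ∀ (K n : ℕ) (h : n ≤ K), ∀ j : ℕ, j < K - n →
      ∀ V : GaugeField (F.P n) 0 (Matrix.specialUnitaryGroup (Fin 2) ℂ), PlaqSmall (θBal F.L γ b₀ p₀ n) V →
        ∀ Y ∈ D.Loc K (K - n) (D.triv K (K - n)) (1 + j), ∀ c : PBond (F.P K) j,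
          B (K + 1) (K + 1 - n) (j + 1) (refineSet F K Y) (fieldShift (F.sitesPerDir_eq (m := F.m) (K := K + 1) (j := K + 1 - n) (m' := F.m) (K' := n) (j' := 0) (by omega)) V) (matchBond F K j c) =
            Φ K (K - n) j Y (Ubar K (K - n) (K + 1 - n) (fieldShift (F.sitesPerDir_eq (m := F.m) (K := K + 1) (j := K + 1 - n) (m' := F.m) (K' := n) (j' := 0) (by omega)) V)) c)
    (hLip : ∀ (K n : ℕ) (h : n ≤ K), ∀ j : ℕ, j < K - n →
      ∀ V : GaugeField (F.P n) 0 (Matrix.specialUnitaryGroup (Fin 2) ℂ), PlaqSmall (θBal F.L γ b₀ p₀ n) V →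
        ∀ Y ∈ D.Loc K (K - n) (D.triv K (K - n)) (1 + j), ∀ c : PBond (F.P K) j,
          ‖Φ K (K - n) j Y (U K (K - n) (fieldShift (F.sitesPerDir_eq (m := F.m) (K := K) (j := K - n) (m' := F.m) (K' := n) (j' := 0) (by omega)) V)) c - Φ K (K - n) j Y (Ubar K (K - n) (K + 1 - n) (fieldShift (F.sitesPerDir_eq (m := F.m) (K := K + 1) (j := K + 1 - n) (m' := F.m) (K' := n) (j' := 0) (by omega)) V)) c‖ ≤
            L_Φ * (1 + dist K j Y c) * (F.L : ℝ) ^ j *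
              δ K (K - n) (U K (K - n) (fieldShift (F.sitesPerDir_eq (m := F.m) (K := K) (j := K - n) (m' := F.m) (K' := n) (j' := 0) (by omega)) V)) (Ubar K (K - n) (K + 1 - n) (fieldShift (F.sitesPerDir_eq (m := F.m) (K := K + 1) (j := K + 1 - n) (m' := F.m) (K' := n) (j' := 0) (by omega)) V)))
    (hFine : ∀ (K n : ℕ) (h : n ≤ K), 0 < K - n → ∀ V : GaugeField (F.P n) 0 (Matrix.specialUnitaryGroup (Fin 2) ℂ), PlaqSmall (θBal F.L γ b₀ p₀ n) V →
        δ K (K - n) (U K (K - n) (fieldShift (F.sitesPerDir_eq (m := F.m) (K := K) (j := K - n) (m' := F.m) (K' := n) (j' := 0) (by omega)) V)) (Ubar K (K - n) (K + 1 - n) (fieldShift (F.sitesPerDir_eq (m := F.m) (K := K + 1) (j := K + 1 - n) (m' := F.m) (K' := n) (j' := 0) (by omega)) V)) ≤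
          C_f * θBal F.L γ b₀ p₀ n * (((F.L : ℝ) ^ (K - n))⁻¹) ^ b) :
    CfgDistCauchyΦ D B dist b₀ p₀ a (L_Φ * C_f) := by
  intro K n hnK j hj V hV Y hY c
  rw [hB K n hnK j hj V hV Y hY, hB' K n hnK j hj V hV Y hY c, norm_sub_rev]
  have hθ : 0 ≤ θBal F.L γ b₀ p₀ n := (T3MinimiserStabilityReduction.θBal_pos hL hγ hγ1 hb p₀ n).le
  have hd : 0 ≤ 1 + dist K j Y c := by linarith [hn K j Y c]
  have hLj : (0 : ℝ) ≤ (F.L : ℝ) ^ j := by positivity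
  have h0 : 0 ≤ L_Φ * (1 + dist K j Y c) * (F.L : ℝ) ^ j := by positivity
  have h1 : 0 ≤ L_Φ * C_f * (1 + dist K j Y c) * θBal F.L γ b₀ p₀ n := mul_nonneg (mul_nonneg (mul_nonneg hLΦ hCf) hd) hθ
  calc _ ≤ L_Φ * (1 + dist K j Y c) * (F.L : ℝ) ^ j * _ := hLip K n hnK j hj V hV Y hY c
    _ ≤ L_Φ * (1 + dist K j Y c) * (F.L : ℝ) ^ j * (C_f * θBal F.L γ b₀ p₀ n * (((F.L : ℝ) ^ (K - n))⁻¹) ^ b) :=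
        mul_le_mul_of_nonneg_left (hFine K n hnK (by omega) V hV) h0
    _ = L_Φ * C_f * (1 + dist K j Y c) * θBal F.L γ b₀ p₀ n * ((F.L : ℝ) ^ j * (((F.L : ℝ) ^ (K - n))⁻¹) ^ b) := by ring
    _ ≤ L_Φ * C_f * (1 + dist K j Y c) * θBal F.L γ b₀ p₀ n * ((((F.L : ℝ) ^ (K - n - 1 - j))⁻¹) ^ 2 * (((F.L : ℝ) ^ (1 + j))⁻¹) ^ a) :=
        mul_le_mul_of_nonneg_left (levelScale_le_T3 hL hb2 hab hj) h1
    _ = L_Φ * C_f * (1 + dist K j Y c) * θBal F.L γ b₀ p₀ n * (((F.L : ℝ) ^ (K - n - 1 - j))⁻¹) ^ 2 * (((F.L : ℝ) ^ (1 + j))⁻¹) ^ a := by ring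

omit [NormedSpace ℂ 𝕍] in
/-- **(R5) `CfgRefOwnΦ` FROM A FINE COMPARISON OF ORDER `b` WITH A REFERENCE BACKGROUND THROUGH `L^j`-LIPSCHITZ CHART MAPS.**  As `cfgRefOwnΦ_of_fineComparison` (displays (B), (R)
verbatim), with (Lip♮) `‖Φ(U) c − Φ(Uref) c‖ ≤ L_Φ·(1 + d(c))·L^j·δ(U, Uref)` ([Balaban1985Averaging] Prop. 6 (164) shape) and (Fine_b) `δ(U, Uref) ≤ C_f·θ(n)·((L^{K−n})⁻¹)^b`;
then `CfgRefOwnΦ D B BR dist b₀ p₀ a (L_Φ·C_f)` for every rate `a` with `a + 1 ≤ b`, `2 ≤ b`.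
[cite: Balaban1985Averaging, Prop. 6 (164) p.43; King1986, Prop. 3.8 (3.71) p.664, Prop. 3.9 (3.73)-(3.74) p.665; Balaban1985UV3, (27) p.263, (44) p.267] -/
theorem cfgRefOwnΦ_of_fineComparison_scale {D : AlphaDataT3 F γ} {B BR : CfgFam 𝕍 F} {dist : LegDist F} {b₀ p₀ a b L_Φ C_f : ℝ} (S : ℕ → Type)
    (U Uref : (K k : ℕ) → GaugeField (F.P K) k (Matrix.specialUnitaryGroup (Fin 2) ℂ) → S K)
    (Φ : (K k b : ℕ) → Set (Site (F.P K) 0) → S K → (PBond (F.P K) b → 𝕍)) (δ : (K k : ℕ) → S K → S K → ℝ)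
    (hn : DistNonneg dist) (hL : 1 ≤ F.L) (hγ : 0 < γ) (hγ1 : γ ≤ 1) (hb : 0 < b₀) (hLΦ : 0 ≤ L_Φ) (hCf : 0 ≤ C_f)
    (hb2 : 2 ≤ b) (hab : a + 1 ≤ b)
    (hB : ∀ (K n : ℕ) (h : n ≤ K), ∀ j : ℕ, j < K - n →
      ∀ V : GaugeField (F.P n) 0 (Matrix.specialUnitaryGroup (Fin 2) ℂ), PlaqSmall (θBal F.L γ b₀ p₀ n) V →
        ∀ Y ∈ D.Loc K (K - n) (D.triv K (K - n)) (1 + j),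
          B K (K - n) j Y (fieldShift (F.sitesPerDir_eq (m := F.m) (K := K) (j := K - n) (m' := F.m) (K' := n) (j' := 0) (by omega)) V) = Φ K (K - n) j Y (U K (K - n) (fieldShift (F.sitesPerDir_eq (m := F.m) (K := K) (j := K - n) (m' := F.m) (K' := n) (j' := 0) (by omega)) V)))
    (hBR : ∀ (K n : ℕ) (h : n ≤ K), ∀ j : ℕ, j < K - n →
      ∀ V : GaugeField (F.P n) 0 (Matrix.specialUnitaryGroup (Fin 2) ℂ), PlaqSmall (θBal F.L γ b₀ p₀ n) V →
        ∀ Y ∈ D.Loc K (K - n) (D.triv K (K - n)) (1 + j),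
          BR K (K - n) j Y (fieldShift (F.sitesPerDir_eq (m := F.m) (K := K) (j := K - n) (m' := F.m) (K' := n) (j' := 0) (by omega)) V) = Φ K (K - n) j Y (Uref K (K - n) (fieldShift (F.sitesPerDir_eq (m := F.m) (K := K) (j := K - n) (m' := F.m) (K' := n) (j' := 0) (by omega)) V)))
    (hLip : ∀ (K n : ℕ) (h : n ≤ K), ∀ j : ℕ, j < K - n →
      ∀ V : GaugeField (F.P n) 0 (Matrix.specialUnitaryGroup (Fin 2) ℂ), PlaqSmall (θBal F.L γ b₀ p₀ n) V →
        ∀ Y ∈ D.Loc K (K - n) (D.triv K (K - n)) (1 + j), ∀ c : PBond (F.P K) j,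
          ‖Φ K (K - n) j Y (U K (K - n) (fieldShift (F.sitesPerDir_eq (m := F.m) (K := K) (j := K - n) (m' := F.m) (K' := n) (j' := 0) (by omega)) V)) c - Φ K (K - n) j Y (Uref K (K - n) (fieldShift (F.sitesPerDir_eq (m := F.m) (K := K) (j := K - n) (m' := F.m) (K' := n) (j' := 0) (by omega)) V)) c‖ ≤
            L_Φ * (1 + dist K j Y c) * (F.L : ℝ) ^ j * δ K (K - n) (U K (K - n) (fieldShift (F.sitesPerDir_eq (m := F.m) (K := K) (j := K - n) (m' := F.m) (K' := n) (j' := 0) (by omega)) V)) (Uref K (K - n) (fieldShift (F.sitesPerDir_eq (m := F.m) (K := K) (j := K - n) (m' := F.m) (K' := n) (j' := 0) (by omega)) V)))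
    (hFine : ∀ (K n : ℕ) (h : n ≤ K), 0 < K - n → ∀ V : GaugeField (F.P n) 0 (Matrix.specialUnitaryGroup (Fin 2) ℂ), PlaqSmall (θBal F.L γ b₀ p₀ n) V →
        δ K (K - n) (U K (K - n) (fieldShift (F.sitesPerDir_eq (m := F.m) (K := K) (j := K - n) (m' := F.m) (K' := n) (j' := 0) (by omega)) V)) (Uref K (K - n) (fieldShift (F.sitesPerDir_eq (m := F.m) (K := K) (j := K - n) (m' := F.m) (K' := n) (j' := 0) (by omega)) V)) ≤ C_f * θBal F.L γ b₀ p₀ n * (((F.L : ℝ) ^ (K - n))⁻¹) ^ b) :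
    CfgRefOwnΦ D B BR dist b₀ p₀ a (L_Φ * C_f) := by
  intro K n hnK j hj V hV Y hY c
  rw [hB K n hnK j hj V hV Y hY, hBR K n hnK j hj V hV Y hY]
  have hθ : 0 ≤ θBal F.L γ b₀ p₀ n := (T3MinimiserStabilityReduction.θBal_pos hL hγ hγ1 hb p₀ n).le
  have hd : 0 ≤ 1 + dist K j Y c := by linarith [hn K j Y c]
  have hLj : (0 : ℝ) ≤ (F.L : ℝ) ^ j := by positivity
  have h0 : 0 ≤ L_Φ * (1 + dist K j Y c) * (F.L : ℝ) ^ j := by positivity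
  have h1 : 0 ≤ L_Φ * C_f * (1 + dist K j Y c) * θBal F.L γ b₀ p₀ n := mul_nonneg (mul_nonneg (mul_nonneg hLΦ hCf) hd) hθ
  calc _ ≤ L_Φ * (1 + dist K j Y c) * (F.L : ℝ) ^ j * _ := hLip K n hnK j hj V hV Y hY c
    _ ≤ L_Φ * (1 + dist K j Y c) * (F.L : ℝ) ^ j * (C_f * θBal F.L γ b₀ p₀ n * (((F.L : ℝ) ^ (K - n))⁻¹) ^ b) :=
        mul_le_mul_of_nonneg_left (hFine K n hnK (by omega) V hV) h0
    _ = L_Φ * C_f * (1 + dist K j Y c) * θBal F.L γ b₀ p₀ n * ((F.L : ℝ) ^ j * (((F.L : ℝ) ^ (K - n))⁻¹) ^ b) := by ring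
    _ ≤ L_Φ * C_f * (1 + dist K j Y c) * θBal F.L γ b₀ p₀ n * ((((F.L : ℝ) ^ (K - n - 1 - j))⁻¹) ^ 2 * (((F.L : ℝ) ^ (1 + j))⁻¹) ^ a) :=
        mul_le_mul_of_nonneg_left (levelScale_le_T3 hL hb2 hab hj) h1
    _ = L_Φ * C_f * (1 + dist K j Y c) * θBal F.L γ b₀ p₀ n * (((F.L : ℝ) ^ (K - n - 1 - j))⁻¹) ^ 2 * (((F.L : ℝ) ^ (1 + j))⁻¹) ^ a := by ring

omit [NormedSpace ℂ 𝕍] in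
/-- **THE I-11 ROW FROM THE VARIATIONAL DISPLAYS WITH `L^j`-LIPSCHITZ CHART MAPS AND A RATE OF ORDER `b`.**  As `cfgDistCauchyΦ_of_variational` (free chart `coord K k : S K → E K k`
into real inner-product spaces; (B), (B′); (Crit) `⟪ga, w − u⟫ = 0`, (Mono) `m‖w − u‖² ≤ ⟪ga − gb, w − u⟫`, (Grad) `|⟪gb, w − u⟫| ≤ Λ‖w − u‖` at `u = coord U_K`, `w = coord Ū_{K+1}`), with
(Lip♮) `‖Φ(U)c − Φ(Ū)c‖ ≤ L_Φ·(1 + d(c))·L^j·‖coord U − coord Ū‖` and (Rate_b) `Λ ≤ m·C_f·θ(n)·((L^{K−n})⁻¹)^b`; then `CfgDistCauchyΦ D B dist b₀ p₀ a (L_Φ·C_f)` for every `a` with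
`a + 1 ≤ b`, `2 ≤ b` (`mul_norm_sq_le_of_inner` + `cfgDistCauchyΦ_of_fineComparison_scale`).
[cite: King1986, Prop. 3.8 (3.71) p.664, Prop. 3.9 (3.73)-(3.74) p.665; Balaban1985Variational, (50)-(54) pp.285-286; Balaban1985Averaging, Prop. 6 (164) p.43] -/
theorem cfgDistCauchyΦ_of_variational_scale {D : AlphaDataT3 F γ} {B : CfgFam 𝕍 F} {dist : LegDist F} {b₀ p₀ a b L_Φ C_f : ℝ} (S : ℕ → Type)
    (E : ℕ → ℕ → Type) [∀ K k, NormedAddCommGroup (E K k)] [∀ K k, InnerProductSpace ℝ (E K k)] (coord : (K k : ℕ) → S K → E K k)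
    (U : (K k : ℕ) → GaugeField (F.P K) k (Matrix.specialUnitaryGroup (Fin 2) ℂ) → S K)
    (Ubar : (K k k' : ℕ) → GaugeField (F.P (K + 1)) k' (Matrix.specialUnitaryGroup (Fin 2) ℂ) → S K)
    (Φ : (K k b : ℕ) → Set (Site (F.P K) 0) → S K → (PBond (F.P K) b → 𝕍))
    (hn : DistNonneg dist) (hL : 1 ≤ F.L) (hγ : 0 < γ) (hγ1 : γ ≤ 1) (hb : 0 < b₀) (hLΦ : 0 ≤ L_Φ) (hCf : 0 ≤ C_f)
    (hb2 : 2 ≤ b) (hab : a + 1 ≤ b)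
    (hB : ∀ (K n : ℕ) (h : n ≤ K), ∀ j : ℕ, j < K - n →
      ∀ V : GaugeField (F.P n) 0 (Matrix.specialUnitaryGroup (Fin 2) ℂ), PlaqSmall (θBal F.L γ b₀ p₀ n) V →
        ∀ Y ∈ D.Loc K (K - n) (D.triv K (K - n)) (1 + j),
          B K (K - n) j Y (fieldShift (F.sitesPerDir_eq (m := F.m) (K := K) (j := K - n) (m' := F.m) (K' := n) (j' := 0) (by omega)) V) = Φ K (K - n) j Y (U K (K - n) (fieldShift (F.sitesPerDir_eq (m := F.m) (K := K) (j := K - n) (m' := F.m) (K' := n) (j' := 0) (by omega)) V)))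
    (hB' : ∀ (K n : ℕ) (h : n ≤ K), ∀ j : ℕ, j < K - n →
      ∀ V : GaugeField (F.P n) 0 (Matrix.specialUnitaryGroup (Fin 2) ℂ), PlaqSmall (θBal F.L γ b₀ p₀ n) V →
        ∀ Y ∈ D.Loc K (K - n) (D.triv K (K - n)) (1 + j), ∀ c : PBond (F.P K) j,
          B (K + 1) (K + 1 - n) (j + 1) (refineSet F K Y) (fieldShift (F.sitesPerDir_eq (m := F.m) (K := K + 1) (j := K + 1 - n) (m' := F.m) (K' := n) (j' := 0) (by omega)) V) (matchBond F K j c) =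
            Φ K (K - n) j Y (Ubar K (K - n) (K + 1 - n) (fieldShift (F.sitesPerDir_eq (m := F.m) (K := K + 1) (j := K + 1 - n) (m' := F.m) (K' := n) (j' := 0) (by omega)) V)) c)
    (hLip : ∀ (K n : ℕ) (h : n ≤ K), ∀ j : ℕ, j < K - n →
      ∀ V : GaugeField (F.P n) 0 (Matrix.specialUnitaryGroup (Fin 2) ℂ), PlaqSmall (θBal F.L γ b₀ p₀ n) V →
        ∀ Y ∈ D.Loc K (K - n) (D.triv K (K - n)) (1 + j), ∀ c : PBond (F.P K) j,
          ‖Φ K (K - n) j Y (U K (K - n) (fieldShift (F.sitesPerDir_eq (m := F.m) (K := K) (j := K - n) (m' := F.m) (K' := n) (j' := 0) (by omega)) V)) c - Φ K (K - n) j Y (Ubar K (K - n) (K + 1 - n) (fieldShift (F.sitesPerDir_eq (m := F.m) (K := K + 1) (j := K + 1 - n) (m' := F.m) (K' := n) (j' := 0) (by omega)) V)) c‖ ≤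
            L_Φ * (1 + dist K j Y c) * (F.L : ℝ) ^ j *
              ‖coord K (K - n) (U K (K - n) (fieldShift (F.sitesPerDir_eq (m := F.m) (K := K) (j := K - n) (m' := F.m) (K' := n) (j' := 0) (by omega)) V)) -
                coord K (K - n) (Ubar K (K - n) (K + 1 - n) (fieldShift (F.sitesPerDir_eq (m := F.m) (K := K + 1) (j := K + 1 - n) (m' := F.m) (K' := n) (j' := 0) (by omega)) V))‖)
    (hVar : ∀ (K n : ℕ) (h : n ≤ K), 0 < K - n → ∀ V : GaugeField (F.P n) 0 (Matrix.specialUnitaryGroup (Fin 2) ℂ), PlaqSmall (θBal F.L γ b₀ p₀ n) V →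
      ∃ (ga gb : E K (K - n)) (m Λ : ℝ), 0 < m ∧
        ⟪ga, coord K (K - n) (Ubar K (K - n) (K + 1 - n) (fieldShift (F.sitesPerDir_eq (m := F.m) (K := K + 1) (j := K + 1 - n) (m' := F.m) (K' := n) (j' := 0) (by omega)) V)) -
              coord K (K - n) (U K (K - n) (fieldShift (F.sitesPerDir_eq (m := F.m) (K := K) (j := K - n) (m' := F.m) (K' := n) (j' := 0) (by omega)) V))⟫ = 0 ∧
        m * ‖coord K (K - n) (Ubar K (K - n) (K + 1 - n) (fieldShift (F.sitesPerDir_eq (m := F.m) (K := K + 1) (j := K + 1 - n) (m' := F.m) (K' := n) (j' := 0) (by omega)) V)) -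
              coord K (K - n) (U K (K - n) (fieldShift (F.sitesPerDir_eq (m := F.m) (K := K) (j := K - n) (m' := F.m) (K' := n) (j' := 0) (by omega)) V))‖ ^ 2 ≤
          ⟪ga - gb, coord K (K - n) (Ubar K (K - n) (K + 1 - n) (fieldShift (F.sitesPerDir_eq (m := F.m) (K := K + 1) (j := K + 1 - n) (m' := F.m) (K' := n) (j' := 0) (by omega)) V)) -
              coord K (K - n) (U K (K - n) (fieldShift (F.sitesPerDir_eq (m := F.m) (K := K) (j := K - n) (m' := F.m) (K' := n) (j' := 0) (by omega)) V))⟫ ∧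
        |⟪gb, coord K (K - n) (Ubar K (K - n) (K + 1 - n) (fieldShift (F.sitesPerDir_eq (m := F.m) (K := K + 1) (j := K + 1 - n) (m' := F.m) (K' := n) (j' := 0) (by omega)) V)) -
              coord K (K - n) (U K (K - n) (fieldShift (F.sitesPerDir_eq (m := F.m) (K := K) (j := K - n) (m' := F.m) (K' := n) (j' := 0) (by omega)) V))⟫| ≤
          Λ * ‖coord K (K - n) (Ubar K (K - n) (K + 1 - n) (fieldShift (F.sitesPerDir_eq (m := F.m) (K := K + 1) (j := K + 1 - n) (m' := F.m) (K' := n) (j' := 0) (by omega)) V)) -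
              coord K (K - n) (U K (K - n) (fieldShift (F.sitesPerDir_eq (m := F.m) (K := K) (j := K - n) (m' := F.m) (K' := n) (j' := 0) (by omega)) V))‖ ∧
        Λ ≤ m * (C_f * θBal F.L γ b₀ p₀ n * (((F.L : ℝ) ^ (K - n))⁻¹) ^ b)) :
    CfgDistCauchyΦ D B dist b₀ p₀ a (L_Φ * C_f) := by
  refine cfgDistCauchyΦ_of_fineComparison_scale S U Ubar Φ (fun K k s s' => ‖coord K k s - coord K k s'‖) hn hL hγ hγ1 hb hLΦ hCf hb2 hab hB hB' hLip ?_
  intro K n hnK hk V hV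
  obtain ⟨ga, gb, m, Λ, hm, hcrit, hmono, hgrad, hrate⟩ := hVar K n hnK hk V hV
  have hθ : 0 ≤ θBal F.L γ b₀ p₀ n := (T3MinimiserStabilityReduction.θBal_pos hL hγ hγ1 hb p₀ n).le
  have hLr : (0 : ℝ) ≤ F.L := by positivity
  have hbud : 0 ≤ C_f * θBal F.L γ b₀ p₀ n * (((F.L : ℝ) ^ (K - n))⁻¹) ^ b := by positivity
  have hsq := mul_norm_sq_le_of_inner hcrit hmono hgrad
  rw [norm_sub_rev]
  set δ := ‖coord K (K - n) (Ubar K (K - n) (K + 1 - n) (fieldShift (F.sitesPerDir_eq (m := F.m) (K := K + 1) (j := K + 1 - n) (m' := F.m) (K' := n) (j' := 0) (by omega)) V)) -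
      coord K (K - n) (U K (K - n) (fieldShift (F.sitesPerDir_eq (m := F.m) (K := K) (j := K - n) (m' := F.m) (K' := n) (j' := 0) (by omega)) V))‖ with hδ
  have hδ0 : 0 ≤ δ := norm_nonneg _
  rcases hδ0.eq_or_lt with h0 | hpos
  · rw [← h0]; exact hbud
  · have h1 : m * δ ≤ Λ := by nlinarith
    have h2 : m * δ ≤ m * (C_f * θBal F.L γ b₀ p₀ n * (((F.L : ℝ) ^ (K - n))⁻¹) ^ b) := h1.trans hrate
    exact le_of_mul_le_mul_left h2 hm

end Fine

/-! ## §3 (Lip♮) met by name for the natural chart maps: the `k`-uniform two-field averaging row ∘ the (27) Lipschitz bound -/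

section TwoField

open scoped Matrix.Norms.L2Operator
open Literature.MathematicalPhysics.QuantumFieldTheory.Balaban1983to89.B10Eq27TorusAxialLog
open Literature.MathematicalPhysics.QuantumFieldTheory.Balaban1983to89.B7Prop1Explicit (l1)
open Literature.MathematicalPhysics.QuantumFieldTheory.Balaban1983to89.ExpMeanLog (expMeanLogSU deltaSU)
open Literature.MathematicalPhysics.QuantumFieldTheory.Balaban1983to89.BlockAveraging (blockAvg)
open Literature.MathematicalPhysics.QuantumFieldTheory.Balaban1983to89.BlockAveragingEMLLinearised (linAvg)

variable {P : Params} {N : ℕ} [NeZero N]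

/-- **THE (27) LOOP VARIABLES OF THE `j`-FOLD AVERAGES OF TWO CLOSE FINE FIELDS DIFFER BY `O((1 + |c₋ − y|₁)·L^j·ρ)`** (any torus `P`, `SU(N)`, flat gauge): if `‖U₂,b − 1‖ ≤ δ` and
`‖U₁,b − U₂,b‖ ≤ ρ` on every finest bond, the four smallness rows of the every-`L` two-field averaging theorem hold at `k ≤ m + K`, and at level `j ≤ k` both contour holonomies
at `(y, c)` lie in the disc `‖· − 1‖ ≤ ρ′ < 1` of the logarithm, then
`‖B(Ū₁^{(j)})(y,c) − B(Ū₂^{(j)})(y,c)‖ ≤ (1 − ρ′)⁻¹·(2|c₋ − y|₁ + 2)·(2(d+1)·L^j·ρ)` — the Lipschitz constant of the natural chart map grows like `L^j`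
(`EMLIterUniformAllL.norm_iter_sub_iter_sub_iterLin_le_uniform_allL`, first conjunct, ∘ `norm_B27T_su_sub_le`).
[cite: Balaban1985Averaging, Prop. 4 (134)–(135) p.38, Prop. 6 (164) p.43; Balaban1985UV3, (27)-(28) p.263, (44) p.267] -/
theorem norm_B27T_iter_sub_le_of_twoField (U₁ U₂ : GaugeField P 0 (Matrix.specialUnitaryGroup (Fin N) ℂ)) {δ ρ : ℝ} (hδ : 0 ≤ δ) (hρ0 : 0 ≤ ρ)
    (hU₂ : ∀ b, ‖((U₂ b : Matrix.specialUnitaryGroup (Fin N) ℂ) : Matrix (Fin N) (Fin N) ℂ) - 1‖ ≤ δ)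
    (hρ : ∀ b, ‖((U₁ b : Matrix.specialUnitaryGroup (Fin N) ℂ) : Matrix (Fin N) (Fin N) ℂ) - ((U₂ b : Matrix.specialUnitaryGroup (Fin N) ℂ) : Matrix (Fin N) (Fin N) ℂ)‖ ≤ ρ)
    (k : ℕ) (hk : k ≤ P.m + P.K)
    (hmδ : (((P.d : ℝ) + 1) * ((18 : ℝ) ^ P.d * (2 + ((P.d : ℝ) + 1) * (18 : ℝ) ^ P.d)) * (324 * (((P.d + 2) * P.L : ℕ) : ℝ) ^ 2) /
        ((P.L : ℝ) * ((P.L : ℝ) - 1))) * (((P.d : ℝ) + 1) * (P.L : ℝ) ^ k * δ) ≤ 1)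
    (h200 : 200 * (((P.d + 2) * P.L : ℕ) : ℝ) * (((P.d : ℝ) + 1) * (P.L : ℝ) ^ k * ρ + ((P.d : ℝ) + 1) * (P.L : ℝ) ^ k * δ) ≤ 1)
    (hm : (((P.d : ℝ) + 1) * ((18 : ℝ) ^ P.d * (2 + ((P.d : ℝ) + 1) * (18 : ℝ) ^ P.d)) * (5200 * (((P.d + 2) * P.L : ℕ) : ℝ) ^ 2) /
        ((P.L : ℝ) * ((P.L : ℝ) - 1))) * (((P.d : ℝ) + 1) * (P.L : ℝ) ^ k * ρ + ((P.d : ℝ) + 1) * (P.L : ℝ) ^ k * δ) ≤ 1)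
    (hN : 4 * (((P.d + 2) * P.L : ℕ) : ℝ) * (((P.d : ℝ) + 1) * (P.L : ℝ) ^ k * ρ + ((P.d : ℝ) + 1) * (P.L : ℝ) ^ k * δ) < deltaSU (Fin N))
    {j : ℕ} (hj : j ≤ k) (y : Site P j) (c : PBond P j) {ρ' : ℝ} (hρ' : ρ' < 1)
    (hh₁ : ‖((holT (unitsField (toUField (Averaging.iter (fun i => blockAvg (P := P) (j := i) (expMeanLogSU (n := Fin N))) j U₁))) y (contourT y c) :
        (Matrix (Fin N) (Fin N) ℂ)ˣ) : Matrix (Fin N) (Fin N) ℂ) - 1‖ ≤ ρ')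
    (hh₂ : ‖((holT (unitsField (toUField (Averaging.iter (fun i => blockAvg (P := P) (j := i) (expMeanLogSU (n := Fin N))) j U₂))) y (contourT y c) :
        (Matrix (Fin N) (Fin N) ℂ)ˣ) : Matrix (Fin N) (Fin N) ℂ) - 1‖ ≤ ρ') :
    ‖B27T (unitsField (toUField (Averaging.iter (fun i => blockAvg (P := P) (j := i) (expMeanLogSU (n := Fin N))) j U₁))) y c -
        B27T (unitsField (toUField (Averaging.iter (fun i => blockAvg (P := P) (j := i) (expMeanLogSU (n := Fin N))) j U₂))) y c‖ ≤
      (1 - ρ')⁻¹ * (2 * l1 (rel y c.src) + 2) * (2 * (((P.d : ℝ) + 1) * (P.L : ℝ) ^ j * ρ)) := by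
  -- a linearised-average family for the two-field theorem (its first conjunct, the only one used, does not depend on it)
  let Q : (i : ℕ) → (PBond P 0 → Matrix (Fin N) (Fin N) ℂ) → PBond P i → Matrix (Fin N) (Fin N) ℂ := fun i =>
    Nat.rec (motive := fun i => (PBond P 0 → Matrix (Fin N) (Fin N) ℂ) → PBond P i → Matrix (Fin N) (Fin N) ℂ)
      (fun Y => Y) (fun _ q Y c => linAvg (q Y) c) i
  have h2f := EMLIterUniformAllL.norm_iter_sub_iter_sub_iterLin_le_uniform_allL Q (fun _ => rfl) (fun _ _ _ => rfl)
    U₁ U₂ hδ hρ0 hU₂ hρ k hk hmδ h200 hm hN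
  have hε : ∀ b : PBond P j,
      ‖((Averaging.iter (fun i => blockAvg (P := P) (j := i) (expMeanLogSU (n := Fin N))) j U₁ b : Matrix.specialUnitaryGroup (Fin N) ℂ) : Matrix (Fin N) (Fin N) ℂ) -
          ((Averaging.iter (fun i => blockAvg (P := P) (j := i) (expMeanLogSU (n := Fin N))) j U₂ b : Matrix.specialUnitaryGroup (Fin N) ℂ) : Matrix (Fin N) (Fin N) ℂ)‖ ≤
        2 * (((P.d : ℝ) + 1) * (P.L : ℝ) ^ j * ρ) := fun b => ((h2f j hj) b).1
  exact norm_B27T_su_sub_le _ _ (by positivity) hε y c hρ' hh₁ hh₂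

variable {F : T3Family}

/-- ★ **(Lip♮) FOR THE NATURAL CHART MAPS ON T³, IN THE ROW'S CURRENCY** (`SU(2)`, `d = 3`, at an anchor attaining the canonical leg distance): under the hypotheses of
`norm_B27T_iter_sub_le_of_twoField` at `P := F.P K`,
`‖B(Ū₁^{(j)})(y,c) − B(Ū₂^{(j)})(y,c)‖ ≤ 2(1 − ρ′)⁻¹·(1 + canonLegDist F K j Y c)·(8·(F.L)^j·ρ)` — display (Lip♮) of `cfgDistCauchyΦ_of_fineComparison_scale` with `L_Φ = 16(1−ρ′)⁻¹`
and `δ := ρ` the bondwise sup distance of the fine pair: the constant grows like `L^j`, NOT like the size factor `x_j²`.  (The GLOBAL flat gauge asks small torus zero-modes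
through the smallness rows; leg by leg the same bound follows from LOCAL gauge data by `Prop7FibreLevelSup.norm_pertVar_iter_le_of_gauge` — not re-derived here.)
[cite: Balaban1985Averaging, Prop. 4 (134)–(135) p.38, Prop. 6 (164) p.43; Balaban1985UV3, (27)-(28) p.263, (44) p.267] -/
theorem norm_B27T_iter_sub_le_canonLegDist_of_twoField {K : ℕ} (Y : Set (Site (F.P K) 0)) {j : ℕ} (c : PBond (F.P K) j) {y : Site (F.P K) j}
    (hy : canonLegDist F K j Y c = pdist c.src y)
    (U₁ U₂ : GaugeField (F.P K) 0 (Matrix.specialUnitaryGroup (Fin 2) ℂ)) {δ ρ : ℝ} (hδ : 0 ≤ δ) (hρ0 : 0 ≤ ρ)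
    (hU₂ : ∀ b, ‖((U₂ b : Matrix.specialUnitaryGroup (Fin 2) ℂ) : Matrix (Fin 2) (Fin 2) ℂ) - 1‖ ≤ δ)
    (hρ : ∀ b, ‖((U₁ b : Matrix.specialUnitaryGroup (Fin 2) ℂ) : Matrix (Fin 2) (Fin 2) ℂ) - ((U₂ b : Matrix.specialUnitaryGroup (Fin 2) ℂ) : Matrix (Fin 2) (Fin 2) ℂ)‖ ≤ ρ)
    (k : ℕ) (hk : k ≤ (F.P K).m + (F.P K).K)
    (hmδ : ((((F.P K).d : ℝ) + 1) * ((18 : ℝ) ^ (F.P K).d * (2 + (((F.P K).d : ℝ) + 1) * (18 : ℝ) ^ (F.P K).d)) * (324 * ((((F.P K).d + 2) * (F.P K).L : ℕ) : ℝ) ^ 2) /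
        (((F.P K).L : ℝ) * (((F.P K).L : ℝ) - 1))) * ((((F.P K).d : ℝ) + 1) * ((F.P K).L : ℝ) ^ k * δ) ≤ 1)
    (h200 : 200 * ((((F.P K).d + 2) * (F.P K).L : ℕ) : ℝ) * ((((F.P K).d : ℝ) + 1) * ((F.P K).L : ℝ) ^ k * ρ + (((F.P K).d : ℝ) + 1) * ((F.P K).L : ℝ) ^ k * δ) ≤ 1)
    (hm : ((((F.P K).d : ℝ) + 1) * ((18 : ℝ) ^ (F.P K).d * (2 + (((F.P K).d : ℝ) + 1) * (18 : ℝ) ^ (F.P K).d)) * (5200 * ((((F.P K).d + 2) * (F.P K).L : ℕ) : ℝ) ^ 2) /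
        (((F.P K).L : ℝ) * (((F.P K).L : ℝ) - 1))) * ((((F.P K).d : ℝ) + 1) * ((F.P K).L : ℝ) ^ k * ρ + (((F.P K).d : ℝ) + 1) * ((F.P K).L : ℝ) ^ k * δ) ≤ 1)
    (hN : 4 * ((((F.P K).d + 2) * (F.P K).L : ℕ) : ℝ) * ((((F.P K).d : ℝ) + 1) * ((F.P K).L : ℝ) ^ k * ρ + (((F.P K).d : ℝ) + 1) * ((F.P K).L : ℝ) ^ k * δ) < deltaSU (Fin 2))
    (hj : j ≤ k) {ρ' : ℝ} (hρ' : ρ' < 1)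
    (hh₁ : ‖((holT (unitsField (toUField (Averaging.iter (fun i => blockAvg (P := F.P K) (j := i) (expMeanLogSU (n := Fin 2))) j U₁))) y (contourT y c) :
        (Matrix (Fin 2) (Fin 2) ℂ)ˣ) : Matrix (Fin 2) (Fin 2) ℂ) - 1‖ ≤ ρ')
    (hh₂ : ‖((holT (unitsField (toUField (Averaging.iter (fun i => blockAvg (P := F.P K) (j := i) (expMeanLogSU (n := Fin 2))) j U₂))) y (contourT y c) :
        (Matrix (Fin 2) (Fin 2) ℂ)ˣ) : Matrix (Fin 2) (Fin 2) ℂ) - 1‖ ≤ ρ') :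
    ‖B27T (unitsField (toUField (Averaging.iter (fun i => blockAvg (P := F.P K) (j := i) (expMeanLogSU (n := Fin 2))) j U₁))) y c -
        B27T (unitsField (toUField (Averaging.iter (fun i => blockAvg (P := F.P K) (j := i) (expMeanLogSU (n := Fin 2))) j U₂))) y c‖ ≤
      2 * (1 - ρ')⁻¹ * (1 + canonLegDist F K j Y c) * (8 * (F.L : ℝ) ^ j * ρ) := by
  have h := norm_B27T_iter_sub_le_of_twoField U₁ U₂ hδ hρ0 hU₂ hρ k hk hmδ h200 hm hN hj y c hρ' hh₁ hh₂
  rw [cast_l1_rel_eq_pdist, ← hy] at h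
  have hd : (((F.P K).d : ℝ) + 1) = 4 := by rw [T3Family.P_d]; norm_num
  have hLK : ((F.P K).L : ℝ) = (F.L : ℝ) := rfl
  rw [hd, hLK] at h
  calc _ ≤ (1 - ρ')⁻¹ * (2 * canonLegDist F K j Y c + 2) * (2 * (4 * (F.L : ℝ) ^ j * ρ)) := h
    _ = 2 * (1 - ρ')⁻¹ * (1 + canonLegDist F K j Y c) * (8 * (F.L : ℝ) ^ j * ρ) := by ring

end TwoField

end Summit.QuantumFields.YangMills.Theorems.GlobalSlackKernelLeg

end
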